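import Literature.NumberTheory.EllipticCurves.Tian2014.CMPointSystemDescentOneSevenRelation
import HarnessLib

/-!
# Tian 2014 Thm. 4.4 at `k = 1` (`n = p₀p₁`, `p₀ ≡ 7`, `p₁ ≡ 1 (mod 8)`) on the `n ≡ 3 (mod 4)` CM-point system, II:
# the telescoping `y₀^{β²} = y₀ + (1, 0)`, the `E[4]` step, and THE DESCENT for both twists —
# `y_{2n} ∉ 2E(ℚ(√−2n))⁻ + E[2]` and `y_n ∉ 2E(ℚ(√−n))⁻ + E[2]` (Monsky Thm. 5.14 (10)/(11), Cor. 5.15 (3))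

Cell `bsd-monsky` (prover-A seat, g15; `run/shared/lean/pub/bsd-monsky/`). HONEST FRAMING (README §1): nothing is asserted
about BSD, nothing is booked, no `_holds`, no named fact; this file PROVES theorems on the data `D : CMPointData n` of
`CMPointSystemDisplays.lean` (Tian's Thm. 2.8 system, the system of the cell's enclosure) with its printed properties as
hypotheses. NOTHING NEW ON PAPER: Tian proves Thm. 4.4 in print by induction on `k`; this is its FIRST STEP `k = 1`
(`n = p₀p₁`, `p₀ ≡ 7`, `p₁ ≡ 1 (mod 8)`, both twists `m = n, 2n`), which is Monsky's Cor. 5.15 (3) «`p₁p₇` and `2p₁p₇` when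
`(p₁/p₇) = −1`» (Thm. 5.14 (10)/(11)), transplanted onto Tian's points by TIAN'S route (Tian's `β`-argument). The one
ANALYTIC input of Tian's step — "(2) for each positive `d` with `p₀ | d | 2n` and `d ≠ n, 2n`, `y_d ∈ 2^k E(ℚ(√−d))⁻ + E[2]`"
(Thm. 3.3, p0021 L62–L70 / p0025 L87–L94) — is the BINDER `hDiv` on the signed point `y_{p₀,φ}` (even twist) resp.
`y_{2p₀,φ}` (odd twist); everything else is the printed skeleton (Thm. 2.8, (4.8), the Galois facts), the §4.2 / Notations
sentences on `√2`, `√p₁ ∈ H₀ ⊂ H` and the classes `[ϖ′] ∈ 2𝒜`, `[t₀]` (`β`), `[ϖ′_{p₁}]` as BINDERS, and two class-group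
cardinalities (`#𝒜[2] = 4`, `#(2𝒜 ∩ 𝒜[2]) = 2` — Gauss and Tian's (1.1); KERNEL THEOREMS in `…DescentOneSevenClassGroup`).

## Source (verbatim, arXiv:1210.8231)

* Thm. 4.4 (p0023 L4–L8): "Let `k ≥ 0` an integer and `n = p₀p₁⋯p_k` a product of distinct primes with `p₀ ≡ 7 mod 8` and
  `p₁, ⋯, p_k ≡ 1 mod 8`. Then for `m = n` or `2n`, `y_m ∈ 2^{k−1}E(ℚ(√−m))⁻ + E[2]`, and if `dim_{𝔽₂} 𝒜[4]/𝒜[2] = 1` then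
  the point `y_m ∉ 2^k E(ℚ(√−m))⁻ + E[2]`."
* Proof (p0025 L82–L94, p0026 L2–L51): "We prove the theorem by induction on `k`. The initial case `k = 0` is given by
  Proposition 4.6. Now assume that `k ≥ 1`. For `m = n` or `2n`, … (2) for each positive `d` with `p₀ | d | 2n` and
  `d ≠ n, 2n`, `y_d ∈ 2^k E(ℚ(√−d))⁻ + E[2]`, i.e. of form `2^k y′_d + t_d` for some `y′_d ∈ E(ℚ(√−d))⁻` and `t_d ∈ E[2]`.
  Now we show that `y_m ∉ 2^k E(ℚ(√−m))⁻ + E[2]` under the condition `dim_{𝔽₂} 𝒜[4]/𝒜[2] = 1`. Suppose it is not the case,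
  i.e. `y_m = 2^k y′_m + t_m` … Thus the previous lemma implies that `P := (y₀ + (−1)^m y₀^β − Σ y′_d) ∈ E[2^{k+1}] ∩ E(H₀) =
  E[4] ∩ E(ℚ(√2))`. It follows that `P^β − P = 0` or `(0, 0)` and `P^β + P = 0` or `(−1, 0)`. The assumption `dim_{𝔽₂}
  𝒜[4]/𝒜[2] = 1` implies that `[ϖ′]` is the unique non-trivial element in `2𝒜 ∩ 𝒜[2]`. Note that `(y′_d)^β = (−1)^m y′_d` and
  therefore `P − (−1)^m P^β = y₀ − y₀^{β²}`. Write `β = σ_{t₀}` … `y₀ − y₀^{β²} = … = (1, 0)`. It is a contradiction."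

## What is proved here (kernel), and from what

* §4 `y₀^{β²} = y₀ + (1, 0)` on the special `φ₀` (g13's telescoping); `σ_{1+ϖ}` shifts `y₀`, `σ_t(y₀)` by `#φ₀·(0, 0)`.
* §5 the `E[4]` step on `E(H)`: `τ` (moves `i`, fixes `√2`), `β` (negates `√2`), `2A = (2S + T) + (2S′ + T′)` with `A, S, S′`
  fixed by `τ`, `β(S) = εS`, `β(S′) = εS′` ⟹ `β(A) − εA ≠ (1, 0)`.
* §6 THE DESCENT, even twist `m = 2n`: `y_{2n,φ} = transfer y″` (the tree's `exists_transfer_eq_yPoint`, Lemma 4.8 (1)) with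
  `y″ ∉ 2E_{2n}(ℚ) + tor`, on Tian's transversal `φ = ⋃_c cφ₀`; §7 the odd twist `m = n`: `y_{n,φ} = transfer_{√−n} y″` (the
  tree's `exists_transferE_eq_yPointChi`) with `y″ ∉ 2E_n(ℚ) + tor`. At `k = 1` Tian's `E[2^{k+1}] ∩ E(H₀) = E[4]` is the
  tautology `E[4] = E[4]`: the ramification sentence is not needed; `E[4] ∩ E(H₀) ⊆ E[4] ∩ E(ℚ(√2))` is the coordinate check
  of `CMPointSystemDescentPrimeSeven` (`τ` fixes `P`, moves `i`).

[cite: Tian2014, Thm. 4.4 (arXiv:1210.8231 p0023 L4–L8) and its proof (p0025 L82–L94, p0026 L2–L51), Lemma 4.8 (p0025 L30–L81), Prop. 4.6 proof (p0024 L6–L30), Thm. 3.3 (p0014 L99–L105), §4.2 (p0022 L47–L96), Notations (i)–(iii) (p0005 L22–L33)]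
[cite: Monsky1990MockHeegner, Thm. 5.14 (10)/(11) and Cor. 5.15 (3) (p. 66)] [cite: Cox2013, Prop. 3.11] [cite: LiMa2008, Thm. 0.4]
-/

noncomputable section

open scoped Classical

open WeierstrassCurve WeierstrassCurve.Affine NumberField Literature.NumberTheory.EllipticCurves
  Literature.NumberTheory.EllipticCurves.TianYuanZhang2017 Literature.GroupTheory.FiniteAbelian
open Literature.NumberTheory.EllipticCurves.Monsky1990 (map_sub_self_eq_zero_of_two_nsmul_eq_zero)

set_option autoImplicit false

namespace Literature.NumberTheory.EllipticCurves.Tian2014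

namespace CMPointData

variable {n : ℕ}

/-! ## §4 `y₀^{β²} = y₀ + (1, 0)` on the special transversal `φ₀ = ⋃_{i<m} [t₀]^{2i} φ₁` -/

/-- **`y₀^{β²} = y₀ + (1, 0)`** for `β = σ_{t₀}` and the special transversal `φ₀ = ⋃_{i<m} ([t₀]²)^i φ₁` of `2𝒜/[ϖ′]`
(`#φ₁` odd, `([t₀]²)^m = [ϖ′]`, `n ≡ 7 (8)`): Tian's "`y₀ − y₀^{β²} = Σ_{[t]∈φ₁}(z_t − z_{ϖ′t}) = #2𝒜/([t₀]²)·(1, 0) = (1, 0)`",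
g13's telescoping. [cite: Tian2014, proof of Thm. 4.4 (p0026 L32–L51)] -/
theorem act_art_art_yPoint_eq_add_ptOne (D : CMPointData n) (hn8 : n % 8 = 7) (h3 : D.thm28_3) (h48 : D.eq48)
    (t₀ : ClassGroup (𝓞 (GenusField (2 * n)))) {φ₀ φ₁ : Finset (ClassGroup (𝓞 (GenusField (2 * n))))} {m : ℕ}
    (htm : (t₀ * t₀) ^ m = D.piPrime) (hodd : Odd φ₁.card)
    (hsum : ∀ {M : Type} [AddCommGroup M] (f : ClassGroup (𝓞 (GenusField (2 * n))) → M),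
      ∑ a ∈ φ₀, f a = ∑ i ∈ Finset.range m, ∑ u ∈ φ₁, f ((t₀ * t₀) ^ i * u)) :
    D.act (D.art t₀) (D.act (D.art t₀) (D.yPoint φ₀)) = D.yPoint φ₀ + ptOne := by
  rw [← D.act_mul, ← map_mul]
  exact D.act_art_yPoint_eq_add_ptOne hn8 h3 h48 (t₀ * t₀) htm hodd hsum

/-- `σ_{1+ϖ}` shifts `σ_t(y₀)` by `#φ₀·(0, 0)` (Thm. 2.8 (1) summand by summand, after (4.8)).
[cite: Tian2014, Lemma 4.8 proof (p0025 L57–L59), Thm. 2.8 (1) (p0011 L39–L40)] -/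
theorem act_tau_act_art_yPoint (D : CMPointData n) (h1 : D.thm28_1) (h48 : D.eq48)
    (t : ClassGroup (𝓞 (GenusField (2 * n)))) (φ₀ : Finset (ClassGroup (𝓞 (GenusField (2 * n))))) :
    D.act D.tau (D.act (D.art t) (D.yPoint φ₀)) = D.act (D.art t) (D.yPoint φ₀) + φ₀.card • ptZero := by
  have h : D.act (D.art t) (D.yPoint φ₀) = ∑ g ∈ φ₀, D.z (t * g) := by
    unfold yPoint
    rw [map_sum]
    exact Finset.sum_congr rfl (fun g _ => h48 t g)
  rw [h, map_sum, Finset.sum_congr rfl (fun g _ => h1 (t * g)), Finset.sum_add_distrib, Finset.sum_const]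

/-- `σ_{1+ϖ}` shifts `y₀` by `#φ₀·(0, 0)`. [cite: Tian2014, Thm. 2.8 (1) (p0011 L39–L40), Lemma 4.9 (4.10) (p0026 L93–L95)] -/
theorem act_tau_yPoint' (D : CMPointData n) (h1 : D.thm28_1)
    (φ₀ : Finset (ClassGroup (𝓞 (GenusField (2 * n))))) :
    D.act D.tau (D.yPoint φ₀) = D.yPoint φ₀ + φ₀.card • ptZero := by
  unfold yPoint
  rw [map_sum, Finset.sum_congr rfl (fun g _ => h1 _), Finset.sum_add_distrib, Finset.sum_const]

/-- `k·(0,0) + k·(0,0) = 0` (`(0,0) ∈ E[2]`). [cite: Tian2014, Thm. 2.8 (1) (p0011 L39–L40)] [folklore] -/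
theorem nsmul_ptZero_add_nsmul_ptZero {H : Type} [Field H] [CharZero H] (k : ℕ) :
    k • (ptZero : EPoint H) + k • (ptZero : EPoint H) = 0 := by
  rw [← two_nsmul, smul_comm, two_nsmul_ptZero, smul_zero]


end CMPointData

/-! ## §5 The `E[4]` step: `P ∈ E[4]` fixed by `τ` (moving `i`, fixing `√2`) cannot satisfy `P^β − εP = (1, 0)` for `β`
negating `√2` -/

section FourTorsionStep

variable {H : Type} [Field H] [CharZero H]

/-- **The contradiction of Tian's proof of Thm. 4.4, on `E(H)`**: for `τ` moving `i` and fixing the square roots of `2`,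
`β` negating them, `ε = ±1`, and points `A, S, S′, T, T′` with `2A = (2S + T) + (2S′ + T′)`, `T, T′ ∈ E[2]`, `τ` fixing
`A, S, S′`, `β(S) = εS`, `β(S′) = εS′`: `β(A) − εA ≠ (1, 0)`. Proof: `P := A − S − S′` has `4P = 0` and `τ(P) = P`, so
`2P ∈ {O, (1,0)}` ("`P ∈ E[4] ∩ E(ℚ(√2))`"); `β(P) − εP = β(A) − εA`; if `2P = O` then `β(P) = P` and `β(P) − εP ∈ {O, 2P} =
{O}`; if `2P = (1,0)` then `β(P) − P ∉ {O, (1,0)}` ("`P^β − P = (0, 0)`, `P^β + P = (−1, 0)`").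
[cite: Tian2014, proof of Thm. 4.4 (p0026 L2–L31), Prop. 4.6 proof (p0024 L11–L14, L26–L30)] -/
theorem map_sub_smul_ne_ptOne (τ β : H ≃ₐ[ℚ] H) (im : H) (him : im ^ 2 = -1) (hτi : τ im = -im)
    (hτ2 : ∀ s : H, s ^ 2 = 2 → τ s = s) (hβ2 : ∀ s : H, s ^ 2 = 2 → β s = -s) {ε : ℤ} (hε : ε = 1 ∨ ε = -1)
    (A S S' T T' : EPoint H) (h2A : (2 : ℕ) • A = (2 : ℕ) • S + T + ((2 : ℕ) • S' + T'))
    (hT : (2 : ℕ) • T = 0) (hT' : (2 : ℕ) • T' = 0)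
    (hτA : Point.map (W' := congruentNumberCurve 1) τ.toAlgHom A = A)
    (hτS : Point.map (W' := congruentNumberCurve 1) τ.toAlgHom S = S)
    (hτS' : Point.map (W' := congruentNumberCurve 1) τ.toAlgHom S' = S')
    (hβS : Point.map (W' := congruentNumberCurve 1) β.toAlgHom S = ε • S)
    (hβS' : Point.map (W' := congruentNumberCurve 1) β.toAlgHom S' = ε • S') :
    Point.map (W' := congruentNumberCurve 1) β.toAlgHom A - ε • A ≠ ptOne := by
  intro hβA
  set P : EPoint H := A - S - S' with hPdef
  have h2P : (2 : ℕ) • P = T + T' := by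
    rw [hPdef, smul_sub, smul_sub, h2A]; abel
  have h4P : (2 : ℕ) • ((2 : ℕ) • P) = 0 := by rw [h2P, smul_add, hT, hT', add_zero]
  have hτP : Point.map (W' := congruentNumberCurve 1) τ.toAlgHom P = P := by
    rw [hPdef, map_sub, map_sub, hτA, hτS, hτS']
  have hβP : Point.map (W' := congruentNumberCurve 1) β.toAlgHom P - ε • P = ptOne := by
    rw [hPdef, map_sub, map_sub, hβS, hβS', ← hβA, smul_sub, smul_sub]; abel
  have hone : (ptOne : EPoint H) ≠ 0 := Point.some_ne_zero _
  rcases two_nsmul_eq_zero_or_ptOne_of_map_eq_self τ im him hτi hτ2 P h4P hτP with h0 | h1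
  · -- `2P = O`: `β(P) = P`
    have hfix := map_sub_self_eq_zero_of_two_nsmul_eq_zero β P h0
    rw [sub_eq_zero] at hfix
    rw [hfix] at hβP
    rcases hε with rfl | rfl
    · rw [one_zsmul, sub_self] at hβP
      exact hone hβP.symm
    · rw [neg_one_zsmul, sub_neg_eq_add, ← two_nsmul, h0] at hβP
      exact hone hβP.symm
  · -- `2P = (1,0)`: `β(P) − P ∉ {O, (1,0)}`
    obtain ⟨hne0, hne1⟩ := map_sub_ne_zero_and_ne_ptOne_of_two_nsmul_eq_ptOne β hβ2 P h1
    rcases hε with rfl | rfl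
    · rw [one_zsmul] at hβP
      exact hne1 hβP
    · rw [neg_one_zsmul, sub_neg_eq_add] at hβP
      apply hne0
      have : Point.map (W' := congruentNumberCurve 1) β.toAlgHom P - P =
          Point.map (W' := congruentNumberCurve 1) β.toAlgHom P + P - (2 : ℕ) • P := by
        rw [two_nsmul]; abel
      rw [this, hβP, h1, sub_self]

end FourTorsionStep


/-! ## §6 THE DESCENT, even twist `m = 2n`: `y_{2n,φ} ∉ 2E(ℚ(√−2n))⁻ + E[2]` -/

namespace CMPointData

variable {n : ℕ} (D : CMPointData n) {θ₂ θ₁ : D.H} {p₀ p₁ : ℕ} {t₀ B : ClassGroup (𝓞 (GenusField (2 * n)))}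

/-- `√−p₀ = √−2n/(√2·√p₁)` squares to `−p₀` when `n = p₀p₁` (plumbing for the transfer to `E_{p₀}`).
[cite: Tian2014, §4.2 (p0022 L77–L83: √−d ∈ H₀ for p₀ | d | 2n)] [folklore] -/
theorem div_mul_sq_eq_neg (hn : n = p₀ * p₁) (hp₁ : p₁ ≠ 0) (hθ₂ : θ₂ ^ 2 = ((2 : ℕ) : D.H))
    (hθ₁ : θ₁ ^ 2 = (p₁ : D.H)) : (D.sqrtNegTwoN / (θ₂ * θ₁)) ^ 2 = algebraMap ℚ D.H (-(p₀ : ℚ)) := by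
  have hcast : ((2 * n : ℕ) : D.H) = ((2 * (p₀ * p₁) : ℕ) : D.H) :=
    congrArg (fun m : ℕ => ((2 * m : ℕ) : D.H)) hn
  rw [div_pow, mul_pow, hθ₂, hθ₁, D.sqrtNegTwoN_sq, map_neg, map_natCast, hcast]
  have hp₁' : (p₁ : D.H) ≠ 0 := Nat.cast_ne_zero.mpr hp₁
  push_cast
  field_simp

/-- `√−p₀ = √−2n/(√2·√p₁) ≠ 0`. [cite: Tian2014, §4.2 (p0022 L77–L83)] [folklore] -/
theorem div_mul_ne_zero (hn0 : n ≠ 0) (hp₁ : p₁ ≠ 0) (hθ₂ : θ₂ ^ 2 = ((2 : ℕ) : D.H))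
    (hθ₁ : θ₁ ^ 2 = (p₁ : D.H)) : D.sqrtNegTwoN / (θ₂ * θ₁) ≠ 0 :=
  div_ne_zero (D.sqrtNegTwoN_ne_zero hn0)
    (mul_ne_zero (ne_zero_of_sq_eq_natCast' two_ne_zero hθ₂) (ne_zero_of_sq_eq_natCast' hp₁ hθ₁))

/-- `√−n = √−2n/√2` squares to `−n`. [cite: Tian2014, §4.2 (p0022 L77–L83)] [folklore] -/
theorem div_two_sq_eq_neg (hθ₂ : θ₂ ^ 2 = ((2 : ℕ) : D.H)) :
    (D.sqrtNegTwoN / θ₂) ^ 2 = algebraMap ℚ D.H (-(n : ℚ)) := by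
  rw [div_pow, hθ₂, D.sqrtNegTwoN_sq, map_neg, map_natCast]
  push_cast
  field_simp

/-- `√−n = √−2n/√2 ≠ 0`. [cite: Tian2014, §4.2 (p0022 L77–L83)] [folklore] -/
theorem div_two_ne_zero (hn0 : n ≠ 0) (hθ₂ : θ₂ ^ 2 = ((2 : ℕ) : D.H)) : D.sqrtNegTwoN / θ₂ ≠ 0 :=
  div_ne_zero (D.sqrtNegTwoN_ne_zero hn0) (ne_zero_of_sq_eq_natCast' two_ne_zero hθ₂)

omit D in
/-- An automorphism negating one square root of `2` negates every square root of `2` ("`σ_t` … moves `√2`", for `β = σ_{t₀}`).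
[cite: Tian2014, p0025 L25–L29, Prop. 4.6 proof (p0024 L26)] [folklore] -/
theorem map_eq_neg_of_sq_eq_two {H : Type} [Field H] [CharZero H] (σ : H ≃ₐ[ℚ] H) {θ₂ : H}
    (hθ₂ : θ₂ ^ 2 = ((2 : ℕ) : H)) (hσ : σ θ₂ = -θ₂) (s : H) (hs : s ^ 2 = 2) : σ s = -s := by
  have hsq : s ^ 2 = θ₂ ^ 2 := by rw [hs, hθ₂]; norm_num
  rcases sq_eq_sq_iff_eq_or_eq_neg.mp hsq with rfl | rfl
  · exact hσ
  · rw [map_neg, hσ, neg_neg]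

/-- **Tian Thm. 4.4 at `k = 1`, the EVEN twist `m = 2n` (= Monsky Thm. 5.14 (11), `2p₁p₇` with `(p₁/p₇) = −1`), the descent
step on the data**: for `n = p₀p₁ ≡ 7 (mod 8)` with `2n` square-free, a system `D` with the printed properties, square roots
`θ₂ = √2`, `θ₁ = √p₁ ∈ H` fixed by `σ_{1+ϖ}` (g13's binder and `√p₁ ∈ H₀ ⊂ H`), the principal-genus sentence `hgen`
("`t ∈ 2𝒜` iff `σ_t` fixes `√2` and `√p₁`", Notations (ii)), "`[ϖ′] ∈ 2𝒜`" (p0025 L22), a class `[t₀]` whose `β = σ_{t₀}`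
moves `√2` and `√p₁` (p0025 L25–L29), the ambiguous class `B = [ϖ′_{p₁}]` (`B² = 1`, `σ_B` fixes `√2`, moves `√p₁`: Notations
(i), (iii) with `(p₁/p₀) = −1`), the kernel cardinalities `#𝒜[2] = 4` and `#(2𝒜 ∩ 𝒜[2]) = 2`, and Tian's printed divisibility
sentence `hDiv : y_{p₀,φ} ∈ 2E(ℚ(√−p₀))⁻ + E[2]` (the consequence of Thm. 3.3 — the ONE analytic input): there is a transversal
`φ` of `𝒜/[ϖ′]` (Tian's `⋃_{[s]∈ψ}[s]φ₀`) for which `y_{2n,φ}` is the transfer of a rational `y″ ∈ E_{2n}(ℚ)` (Lemma 4.8 (1) /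
Monsky Thm. 4.7) with `y″ ∉ 2E_{2n}(ℚ) + E_{2n}(ℚ)_tor`. Proof as printed: if `y_{2n,φ} = 2S + T`, (4.9) gives
`2(y₀ + y₀^β − S − S′) = T + T′` so `P := y₀ + y₀^β − S − S′ ∈ E[4]`; `σ_{1+ϖ}` fixes `P` so `2P ∈ {O, (1,0)}`; `β` fixes `S`,
`S′` (transfer images along `√−2n`, `√−p₀`) so `P^β − P = y₀^{β²} − y₀ = (1, 0)` — impossible on `E[4] ∩ E(ℚ(√2))`.
[cite: Tian2014, Thm. 4.4 (p0023 L4–L8), Lemma 4.8 (p0025 L30–L81), proof of Thm. 4.4 (p0025 L82–p0026 L51)]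
[cite: Monsky1990MockHeegner, Thm. 5.14 (11), Cor. 5.15 (3) (p. 66)] -/
theorem exists_isReps_transfer_eq_yPoint_not_two_smul_add_torsion_seven_one (hn : n = p₀ * p₁) (hn0 : n ≠ 0)
    (hn8 : n % 8 = 7) (hp₁ : p₁ ≠ 0) (hsq2n : Squarefree (2 * n)) (hP : D.Printed)
    (hθ₂ : θ₂ ^ 2 = ((2 : ℕ) : D.H)) (hθ₁ : θ₁ ^ 2 = (p₁ : D.H))
    (hτ2 : ∀ s : D.H, s ^ 2 = 2 → D.tau s = s) (hτθ₁ : D.tau θ₁ = θ₁)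
    (hgen : ∀ s, (D.art s θ₂ = θ₂ ∧ D.art s θ₁ = θ₁) ↔ IsSquare s) (hπsq : IsSquare D.piPrime)
    (hβ2 : D.art t₀ θ₂ = -θ₂) (hβ1 : D.art t₀ θ₁ = -θ₁)
    (hB2 : B * B = 1) (hBθ₂ : D.art B θ₂ = θ₂) (hBθ₁ : D.art B θ₁ = -θ₁)
    (hfour : Nat.card {c : ClassGroup (𝓞 (GenusField (2 * n))) // c ^ 2 = 1} = 4)
    (h11 : fourTwoCard (ClassGroup (𝓞 (GenusField (2 * n)))) = 2)
    (hDiv : ∀ φ : Finset (ClassGroup (𝓞 (GenusField (2 * n)))), D.IsRepsModPiPrime φ →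
      ∃ (w : (congruentNumberCurve p₀).toAffine.Point) (T' : EPoint D.H), (2 : ℕ) • T' = 0 ∧
        D.yPointChi (D.sqrtNegTwoN / (θ₂ * θ₁)) φ =
          transferE p₀ (D.sqrtNegTwoN / (θ₂ * θ₁)) (D.div_mul_sq_eq_neg hn hp₁ hθ₂ hθ₁)
            (D.div_mul_ne_zero hn0 hp₁ hθ₂ hθ₁) ((2 : ℕ) • w) + T') :
    ∃ φ : Finset (ClassGroup (𝓞 (GenusField (2 * n)))), D.IsRepsModPiPrime φ ∧
      ∃ y' : (congruentNumberCurve (2 * n)).toAffine.Point, D.transfer hn0 y' = D.yPoint φ ∧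
        ∀ z t : (congruentNumberCurve (2 * n)).toAffine.Point, IsOfFinAddOrder t → y' ≠ (2 : ℤ) • z + t := by
  classical
  have hP' := hP
  obtain ⟨h1, -, h3, h48, hart, ⟨htaui, htauθ, -⟩, -, -, -, hπ2, hπ1⟩ := hP'
  have hart' : ∀ s, D.art s D.sqrtNegTwoN = D.sqrtNegTwoN := fun s => (hart s).2
  have hne₂ := D.theta₂_ne_neg hθ₂
  have hne₁ := D.theta₁_ne_neg hp₁ hθ₁
  have hθ₂2 : θ₂ ^ 2 = 2 := by rw [hθ₂]; norm_num
  -- `B ∉ {1, [ϖ′]}`: `σ_B` moves `√p₁`, squares do not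
  have hB1 : B ≠ 1 := by
    intro h; rw [h, map_one, AlgEquiv.one_apply] at hBθ₁; exact hne₁ hBθ₁
  have hBπ : B ≠ D.piPrime := by
    intro h; rw [h, ((hgen _).mpr hπsq).2] at hBθ₁; exact hne₁ hBθ₁
  -- `2𝒜 ∩ 𝒜[2] = {1, [ϖ′]}` (condition (1.1)) and `𝒜[2] = {1, [ϖ′], B, [ϖ′]B}` (Gauss)
  have h2A := eq_one_or_eq_of_isSquare_of_mul_self_eq_one_of_fourTwoCard_eq_two D.piPrime hπsq hπ2 hπ1 h11
  have hA2 := eq_one_or_eq_of_mul_self_eq_one_of_natCard_eq_four D.piPrime B hπ2 hπ1 hB2 hB1 hBπ hfour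
  -- every class of order `≤ 2` fixes `√2`
  have hfix2 : ∀ w, w * w = 1 → D.art w θ₂ = θ₂ := by
    intro w hw
    rcases hA2 w hw with rfl | rfl | rfl | rfl
    · rw [map_one, AlgEquiv.one_apply]
    · exact ((hgen _).mpr hπsq).1
    · exact hBθ₂
    · rw [map_mul, AlgEquiv.mul_apply, hBθ₂, ((hgen _).mpr hπsq).1]
  -- `[t₀]²` is a square but not the square of a square ("`[t₀]` has order `4s`")
  have htsq : IsSquare (t₀ * t₀) := ⟨t₀, rfl⟩
  have ht : ¬ ∃ r, IsSquare r ∧ t₀ * t₀ = r * r := by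
    rintro ⟨r, hr, hrt⟩
    have hw : (t₀ * r⁻¹) * (t₀ * r⁻¹) = 1 := by
      rw [mul_mul_mul_comm, hrt, mul_mul_mul_comm, mul_inv_cancel, mul_one]
    have := hfix2 _ hw
    rw [map_mul, AlgEquiv.mul_apply, ((hgen _).mpr ((isSquare_inv).mpr hr)).1, hβ2] at this
    exact hne₂ this.symm
  obtain ⟨φ₀, φ₁, m, htm, hodd, hφ₀S, hφ₀, hsum⟩ :=
    exists_special_transversal_isSquare D.piPrime hπsq h2A (t₀ * t₀) htsq ht
  -- Tian's transversal `φ = ⋃_i c_i φ₀`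
  have hC := D.exists_reps_isSquare hp₁ hθ₂ hθ₁ hgen hβ2 hβ1 hBθ₂ hBθ₁
  have hCu := D.reps_eq_of_isSquare hp₁ hθ₂ hθ₁ hgen hβ2 hβ1 hBθ₂ hBθ₁
  set φ : Finset (ClassGroup (𝓞 (GenusField (2 * n)))) :=
    ((Finset.univ : Finset (Fin 4)) ×ˢ φ₀).image (fun p => reps t₀ B p.1 * p.2) with hφdef
  have hφ : D.IsRepsModPiPrime φ := isReps_image_mul_of_isReps_isSquare hπsq (reps t₀ B) hC hCu hφ₀S hφ₀
  obtain ⟨y', hy'⟩ := D.exists_transfer_eq_yPoint hn0 hP hB2 hB1 hBπ hφ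
  refine ⟨φ, hφ, y', hy', ?_⟩
  intro z t ht heq
  obtain ⟨w, T', hT'2, hyP0⟩ := hDiv φ hφ
  have ht2 : (2 : ℕ) • t = 0 := two_nsmul_eq_zero_of_isOfFinAddOrder_congruentNumberCurve hsq2n ht
  set S : EPoint D.H := D.transfer hn0 z with hS
  set T : EPoint D.H := D.transfer hn0 t with hT
  set S' : EPoint D.H := transferE p₀ (D.sqrtNegTwoN / (θ₂ * θ₁)) (D.div_mul_sq_eq_neg hn hp₁ hθ₂ hθ₁)
    (D.div_mul_ne_zero hn0 hp₁ hθ₂ hθ₁) w with hS'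
  have hyn : D.yPoint φ = (2 : ℕ) • S + T := by
    rw [← hy', heq, map_add, map_zsmul, two_zsmul, two_nsmul]
  have hyP0' : D.yPointChi (D.sqrtNegTwoN / (θ₂ * θ₁)) φ = (2 : ℕ) • S' + T' := by rw [hyP0, map_nsmul]
  have hT2 : (2 : ℕ) • T = 0 := by rw [hT, ← map_nsmul, ht2, map_zero]
  -- (4.9) at `k = 1`
  have h49 := D.yPointChi_add_yPoint_eq_two_nsmul_add hp₁ hn0 hθ₂ hθ₁ hgen hβ2 hβ1 hBθ₂ hBθ₁ hφ₀S hP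
  rw [hyP0', hyn] at h49
  set y₀ : EPoint D.H := D.yPoint φ₀ with hy₀
  set A : EPoint D.H := y₀ + D.act (D.art t₀) y₀ with hA
  have h2A' : (2 : ℕ) • A = (2 : ℕ) • S + T + ((2 : ℕ) • S' + T') := by rw [hA, ← h49]; abel
  -- `σ_{1+ϖ}` fixes `A`, `S`, `S′`
  have hτA : D.act D.tau A = A := by
    rw [hA, map_add, D.act_tau_yPoint' h1, D.act_tau_act_art_yPoint h1 h48]
    have h0 := nsmul_ptZero_add_nsmul_ptZero (H := D.H) φ₀.card
    rw [show y₀ + φ₀.card • ptZero + (D.act (D.art t₀) y₀ + φ₀.card • ptZero) =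
      (y₀ + D.act (D.art t₀) y₀) + (φ₀.card • ptZero + φ₀.card • ptZero) by abel, h0, add_zero]
  have hτS : D.act D.tau S = S := by
    rw [hS]; exact act_transferE_of_fix (2 * n) _ _ _ _ htauθ z
  have hτθ' : D.tau (D.sqrtNegTwoN / (θ₂ * θ₁)) = D.sqrtNegTwoN / (θ₂ * θ₁) := by
    rw [map_div₀, htauθ, map_mul, hτ2 θ₂ hθ₂2, hτθ₁]
  have hτS' : D.act D.tau S' = S' := by
    rw [hS']; exact act_transferE_of_fix p₀ _ _ _ _ hτθ' w
  -- `β` fixes `S`, `S′` (`ε = 1`)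
  have hβS : D.act (D.art t₀) S = (1 : ℤ) • S := by
    rw [one_zsmul, hS]; exact act_transferE_of_fix (2 * n) _ _ _ _ (hart' t₀) z
  have hβθ' : D.art t₀ (D.sqrtNegTwoN / (θ₂ * θ₁)) = D.sqrtNegTwoN / (θ₂ * θ₁) := by
    rw [map_div₀, hart' t₀, map_mul, hβ2, hβ1, neg_mul_neg]
  have hβS' : D.act (D.art t₀) S' = (1 : ℤ) • S' := by
    rw [one_zsmul, hS']; exact act_transferE_of_fix p₀ _ _ _ _ hβθ' w
  -- `β(A) − A = y₀^{β²} − y₀ = (1, 0)`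
  have hβA : D.act (D.art t₀) A - (1 : ℤ) • A = ptOne := by
    rw [one_zsmul, hA, map_add, D.act_art_art_yPoint_eq_add_ptOne hn8 h3 h48 t₀ htm hodd hsum]
    abel
  exact map_sub_smul_ne_ptOne D.tau (D.art t₀) D.im D.im_sq htaui hτ2
    (map_eq_neg_of_sq_eq_two (D.art t₀) hθ₂ hβ2) (Or.inl rfl) A S S' T T' h2A' hT2 hT'2 hτA hτS hτS' hβS hβS' hβA

end CMPointData

end Literature.NumberTheory.EllipticCurves.Tian2014

end
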